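import Summits.Ventures.PercRepro.C041ZoneZSkelDefs

/-!
# An indexed zone of the skeleton as a zone with forced edges (p6, gen 27; C-041.md §11–§12, the per-zone
dictionary — part 1)

For an indexed zone `Z` of the bare colouring `O` (`IsIdxZone`, `C041ZoneSplitDefs`) the zone-states of the tree
(`ZoneState a b Z`: colourings of the edges of `Z` — the bare edges inside `Z` and the terminal edges at its vertices)
are the states of an abstract zone with forced edges (`zoneFZ a b O Z`, an `FZone`): edges = the bare edges inside `Z`
(`ZBare`), `1`- / `2`-edges = the terminal edges at the vertices of `Z` (`ZT1`, `ZT2`) with their non-terminal end,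
free = the blue `O`-edges, forced colour = the `O`-colour (the red `O`-chords are forced red), no blue-isolated region
(`iso = ∅`).  `toStZ` / `ofStZ` are inverse to each other (`ofStZ_toStZ`, `toStZ_ofStZ`).  Also: a blue bare `O`-edge
inside an indexed zone is an interior blue edge (`interiorBlue_of_idxZone`), and the extension of a zone-state whose
red `O`-chords are red is blue-below `O` (`blueSub_extZone_of_chords`).
-/

namespace PercRepro

namespace MultiGraph

open Finset ZoneZ

variable {V E : Type*} (G : MultiGraph V E) (a b : V)

/-- The bare edges inside `Z`. -/
abbrev ZBare (Z : Finset V) := {e : E // G.Bare a b e ∧ G.fst e ∈ Z ∧ G.snd e ∈ Z}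

/-- The `a`-edges at the vertices of `Z`. -/
abbrev ZT1 (Z : Finset V) := {e : E // ∃ v ∈ Z, G.Joins e v a}

/-- The `b`-edges at the vertices of `Z`. -/
abbrev ZT2 (Z : Finset V) := {e : E // ∃ v ∈ Z, G.Joins e v b}

variable {G a b}

/-- A bare edge inside `Z` is an edge of `Z`. -/
theorem zoneEdge_of_zBare {Z : Finset V} {e : E} (h : G.Bare a b e ∧ G.fst e ∈ Z ∧ G.snd e ∈ Z) :
    G.ZoneEdge a b Z e := Or.inl h

/-- An `a`-edge at a vertex of `Z` is an edge of `Z`. -/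
theorem zoneEdge_of_zT1 {Z : Finset V} {e : E} (h : ∃ v ∈ Z, G.Joins e v a) : G.ZoneEdge a b Z e :=
  Or.inr (h.imp fun _ hv => ⟨hv.1, Or.inl hv.2⟩)

/-- A `b`-edge at a vertex of `Z` is an edge of `Z`. -/
theorem zoneEdge_of_zT2 {Z : Finset V} {e : E} (h : ∃ v ∈ Z, G.Joins e v b) : G.ZoneEdge a b Z e :=
  Or.inr (h.imp fun _ hv => ⟨hv.1, Or.inr hv.2⟩)

/-- An edge of `Z` that is no terminal edge at a vertex of `Z` is a bare edge inside `Z`. -/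
theorem zBare_of_zoneEdge {Z : Finset V} {e : E} (he : G.ZoneEdge a b Z e) (h1 : ¬ ∃ v ∈ Z, G.Joins e v a)
    (h2 : ¬ ∃ v ∈ Z, G.Joins e v b) : G.Bare a b e ∧ G.fst e ∈ Z ∧ G.snd e ∈ Z := by
  rcases he with he | ⟨v, hv, hj | hj⟩
  · exact he
  · exact absurd ⟨v, hv, hj⟩ h1
  · exact absurd ⟨v, hv, hj⟩ h2

/-- A bare edge is no terminal edge at a vertex of `Z`. -/
theorem not_zT1_of_bare {Z : Finset V} {e : E} (he : G.Bare a b e) : ¬ ∃ v ∈ Z, G.Joins e v a := by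
  rintro ⟨v, _, hj⟩
  exact he.1 (EdgeAt.of_joins_right hj)

/-- A bare edge is no terminal edge at a vertex of `Z`. -/
theorem not_zT2_of_bare {Z : Finset V} {e : E} (he : G.Bare a b e) : ¬ ∃ v ∈ Z, G.Joins e v b := by
  rintro ⟨v, _, hj⟩
  exact he.2 (EdgeAt.of_joins_right hj)

/-- With distinct terminals and a zone of non-terminals, a `b`-edge at `Z` is no `a`-edge at `Z`. -/
theorem not_zT1_of_zT2 (hne : a ≠ b) {Z : Finset V} (hZ : ∀ v ∈ Z, v ≠ a ∧ v ≠ b) {e : E}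
    (h : ∃ v ∈ Z, G.Joins e v b) : ¬ ∃ v ∈ Z, G.Joins e v a := by
  obtain ⟨v, hv, hj⟩ := h
  rintro ⟨v', hv', hj'⟩
  exact not_termA_of_termB hne ⟨v, (hZ v hv).1, (hZ v hv).2, hj⟩ ⟨v', (hZ v' hv').1, (hZ v' hv').2, hj'⟩

/-- A blue bare `O`-edge inside an indexed zone is an interior blue edge of `O`. -/
theorem interiorBlue_of_idxZone [Fintype V] {c : V} {O : Config E} {Z : Finset V} (hZ : G.IsIdxZone a b c O Z)
    {e : E} (he : G.Bare a b e ∧ G.fst e ∈ Z ∧ G.snd e ∈ Z) (hO : O e = false) : G.InteriorBlue a b O e := by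
  obtain ⟨⟨z, rfl⟩, _, v, hv, e', he'⟩ := hZ
  refine ⟨he.1, hO, v, ⟨e', he'⟩, ?_⟩
  rw [mem_zone] at hv
  have hf : G.fst e ∈ G.zone a b O z := he.2.1
  rw [mem_zone] at hf
  exact hv.symm.trans hf

/-- The extension of a zone-state whose red `O`-chords are red is blue-below `O`. -/
theorem blueSub_extZone_of_chords {O : Config E} {Z : Finset V} {x : G.ZoneState a b Z}
    (hx : ∀ e (h : G.ZoneEdge a b Z e), G.Bare a b e → O e = true → x ⟨e, h⟩ = true) :
    G.BlueSub a b O (G.extZone a b O Z x) := by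
  intro e he hSe
  by_cases hZ : G.ZoneEdge a b Z e
  · rw [extZone_of_zoneEdge x hZ] at hSe
    by_contra hO
    have hO' : O e = true := by
      cases h : O e
      · exact absurd h hO
      · rfl
    rw [hx e hZ he hO'] at hSe
    exact absurd hSe (by decide)
  · rw [extZone_of_bare x hZ he] at hSe
    exact hSe

variable (G a b)

/-- **An indexed zone as a zone with forced edges**: edges = the bare edges inside `Z`, terminal edges = the terminal
edges at the vertices of `Z`, free = the blue `O`-edges, forced colour = the `O`-colour, no blue-isolated region. -/
noncomputable def zoneFZ (O : Config E) (Z : Finset V) : FZone V (G.ZBare a b Z) (G.ZT1 a Z) (G.ZT2 b Z) where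
  fst e := G.fst e.1
  snd e := G.snd e.1
  at₁ t := G.nonTermEnd a b t.1
  at₂ t := G.nonTermEnd a b t.1
  free e := O e.1 = false
  fcol e := O e.1
  iso := ∅
  fblue_mem := by
    intro e hfree hcol
    exact absurd hcol hfree
  iso_forced := by
    rintro e (h | h) <;> exact absurd h (Set.notMem_empty _)
  iso_unmarked₁ := fun _ => Set.notMem_empty _
  iso_unmarked₂ := fun _ => Set.notMem_empty _

/-- A zone-state of the tree as a state of the abstract zone. -/
def toStZ (Z : Finset V) (x : G.ZoneState a b Z) :
    State (G.ZBare a b Z) (G.ZT1 a Z) (G.ZT2 b Z) :=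
  (fun e => x ⟨e.1, zoneEdge_of_zBare e.2⟩, fun t => x ⟨t.1, zoneEdge_of_zT1 t.2⟩,
    fun t => x ⟨t.1, zoneEdge_of_zT2 t.2⟩)

open Classical in
/-- A state of the abstract zone as a zone-state of the tree. -/
noncomputable def ofStZ (Z : Finset V) (σ : State (G.ZBare a b Z) (G.ZT1 a Z) (G.ZT2 b Z)) :
    G.ZoneState a b Z := fun e =>
  if h1 : ∃ v ∈ Z, G.Joins e.1 v a then σ.2.1 ⟨e.1, h1⟩
  else if h2 : ∃ v ∈ Z, G.Joins e.1 v b then σ.2.2 ⟨e.1, h2⟩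
  else σ.1 ⟨e.1, zBare_of_zoneEdge e.2 h1 h2⟩

variable {G a b}

/-- `ofStZ` inverts `toStZ`. -/
theorem ofStZ_toStZ (Z : Finset V) (x : G.ZoneState a b Z) :
    G.ofStZ a b Z (G.toStZ a b Z x) = x := by
  funext e
  unfold ofStZ toStZ
  by_cases h1 : ∃ v ∈ Z, G.Joins e.1 v a
  · rw [dif_pos h1]
  · rw [dif_neg h1]
    by_cases h2 : ∃ v ∈ Z, G.Joins e.1 v b
    · rw [dif_pos h2]
    · rw [dif_neg h2]

/-- `toStZ` inverts `ofStZ` (distinct terminals, a zone of non-terminals). -/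
theorem toStZ_ofStZ (hne : a ≠ b) {Z : Finset V} (hZ : ∀ v ∈ Z, v ≠ a ∧ v ≠ b)
    (σ : State (G.ZBare a b Z) (G.ZT1 a Z) (G.ZT2 b Z)) : G.toStZ a b Z (G.ofStZ a b Z σ) = σ := by
  obtain ⟨c₁, m₁, m₂⟩ := σ
  unfold toStZ ofStZ
  refine Prod.ext (funext fun e => ?_) (Prod.ext (funext fun t => ?_) (funext fun t => ?_))
  · simp only
    rw [dif_neg (not_zT1_of_bare e.2.1), dif_neg (not_zT2_of_bare e.2.1)]
  · simp only
    rw [dif_pos t.2]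
  · simp only
    rw [dif_neg (not_zT1_of_zT2 hne hZ t.2), dif_pos t.2]

/-- `toStZ` is injective. -/
theorem toStZ_injective (Z : Finset V) : Function.Injective (G.toStZ a b Z) := by
  intro x x' h
  rw [← ofStZ_toStZ Z x, ← ofStZ_toStZ Z x', h]

/-- `ofStZ` is injective (distinct terminals, a zone of non-terminals). -/
theorem ofStZ_injective (hne : a ≠ b) {Z : Finset V} (hZ : ∀ v ∈ Z, v ≠ a ∧ v ≠ b) :
    Function.Injective (G.ofStZ a b Z) := by
  intro σ σ' h
  rw [← toStZ_ofStZ hne hZ σ, ← toStZ_ofStZ hne hZ σ', h]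

/-- The colour of a bare edge inside `Z` in `toStZ x` is its colour in the extension. -/
theorem toStZ_fst (O : Config E) (Z : Finset V) (x : G.ZoneState a b Z) (e : G.ZBare a b Z) :
    (G.toStZ a b Z x).1 e = G.extZone a b O Z x e.1 := by
  rw [extZone_of_zoneEdge x (zoneEdge_of_zBare e.2)]
  rfl

/-- The colour of an `a`-edge at `Z` in `toStZ x` is its colour in the extension. -/
theorem toStZ_snd_fst (O : Config E) (Z : Finset V) (x : G.ZoneState a b Z) (t : G.ZT1 a Z) :
    (G.toStZ a b Z x).2.1 t = G.extZone a b O Z x t.1 := by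
  rw [extZone_of_zoneEdge x (zoneEdge_of_zT1 t.2)]
  rfl

/-- The colour of a `b`-edge at `Z` in `toStZ x` is its colour in the extension. -/
theorem toStZ_snd_snd (O : Config E) (Z : Finset V) (x : G.ZoneState a b Z) (t : G.ZT2 b Z) :
    (G.toStZ a b Z x).2.2 t = G.extZone a b O Z x t.1 := by
  rw [extZone_of_zoneEdge x (zoneEdge_of_zT2 t.2)]
  rfl

end MultiGraph

end PercRepro
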